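import Summits.PneNP.PneNP.Theorems.ExpanderLinearGeneratorsColumnTwoSigmaPrep

/-!
# PneNP / ExpanderLinearGenerators — column weight two: the routing substitution

Route `PneNP/ExpanderLinearGenerators`, support for crux stmt-PneNP-11443. Given a source system `E`
over `𝔽₂` of column weight `≤ 2`, a target system `E'` in which every variable lies in exactly two
rows, has support `≤ k₀` per row and odd total right-hand side, and inside EVERY odd closed
component of `E` a `K_{m'}` minor model indexed by the target rows, we build ONE substitution
`σ` on the variables of `E` such that every clause of `sumEncoding 1 E`, after `σ`, is a tautology
or is implied by the `≤ 2^{k₀}` clauses of one target equation, all on the `≤ k₀` variables of that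
equation (`exists_routing_subst`) — the hypothesis `hloc` of
`TextbookFrege.transfer_isDepthProofOf`. The substitution: `σ v = φ v ⊕ ⨁ {y_x : v ∈ J x}`
(`parityForm`), `J x` the joins of `exists_routing` in the component of `v`, and `φ` a Boolean
solution of the system `E` with right-hand sides corrected at the roots by the target charges
(`exists_assignment_of_even`).

[folklore; Urquhart–Fu 1996, Ben-Sasson 2002 (routing reductions), in minor/`T`-join form]
-/

namespace Summit.PneNP.PneNP.Theorems.ColumnTwo

open Finset Literature.Computability.MetaComplexity Literature.Computability.MetaComplexity.TextbookFrege
open Literature.Computability.Complexity (PropForm Clause CNF Literal)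
open Literature.Computability.MetaComplexity.KrajicekRamsey (litOf clauseOf)

variable {m n m' n' : ℕ}

/-! ### The substitution -/

/-- **The routing substitution.** Let `E` be a system over `𝔽₂` of column weight `≤ 2` and `E'` a
target system in which every variable lies in exactly two rows, every row has support `≤ k₀` and
the right-hand sides have odd sum. Suppose that inside every ODD CLOSED COMPONENT `K` of `E`
(nonempty, connected, boundaryless, odd right-hand side sum) there is a `K_{m'}` minor model
`T : Fin m' → Finset (Fin m)` (connected nonempty pairwise disjoint parts of `K`, adjacent whenever
the target rows share a variable). Then there is a substitution `σ` with `|σ v| ≤ 9 · 2^{k₀}`,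
auxiliary alternation depths `≤ 3 k₀`, such that every clause of `sumEncoding 1 E` after `σ` is
implied by at most `2^{k₀}` clauses of `sumEncoding 1 E'` on the `≤ k₀` variables of one target
equation (the hypothesis `hloc` of `transfer_isDepthProofOf` with `qq = 2^{k₀}`, `k = k₀`).
[folklore; Urquhart–Fu 1996 / Ben-Sasson 2002 routing, in minor form] -/
theorem exists_routing_subst (E : Fin m → LinEqMod 2 n) (E' : Fin m' → LinEqMod 2 n') {k₀ : ℕ}
    (hcol : ∀ j : Fin n, (Finset.univ.filter fun i => j ∈ (E i).supp).card ≤ 2)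
    (hcol2 : ∀ x : Fin n', (Finset.univ.filter fun a => x ∈ (E' a).supp).card = 2)
    (hsupp' : ∀ a, (E' a).supp.card ≤ k₀) (hodd' : ∑ a, (E' a).2 = 1)
    (hemb : ∀ K : Finset (Fin m), K.Nonempty → IsConn (fun i => (E i).supp.map Fin.valEmbedding) K →
      boundary (fun i => (E i).supp.map Fin.valEmbedding) K = ∅ → ∑ i ∈ K, (E i).2 = 1 →
      ∃ T : Fin m' → Finset (Fin m),
        (∀ a, T a ⊆ K ∧ IsConn (fun i => (E i).supp.map Fin.valEmbedding) (T a) ∧ (T a).Nonempty) ∧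
        (∀ a b, a ≠ b → Disjoint (T a) (T b)) ∧
        (∀ a b, a ≠ b → ((E' a).supp ∩ (E' b).supp).Nonempty → ∃ i ∈ T a, ∃ j ∈ T b,
          ((E i).supp.map Fin.valEmbedding ∩ (E j).supp.map Fin.valEmbedding).Nonempty)) :
    ∃ σ : ℕ → PropForm ℕ, (∀ v, (σ v).size ≤ 9 * 2 ^ k₀) ∧
      (∀ v c, PropForm.altDepthAux c (σ v) ≤ 3 * k₀) ∧
      ∀ c ∈ sumEncoding 1 E, ∃ (Lc : List (Clause ℕ)) (V : List ℕ), (∀ C ∈ Lc, C ∈ sumEncoding 1 E') ∧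
        Lc.length ≤ 2 ^ k₀ ∧ V.Nodup ∧ V.length ≤ k₀ ∧ (∀ x ∈ ((clauseOf c).subst σ).vars, x ∈ V) ∧
        (∀ C ∈ Lc, ∀ x ∈ (clauseOf C).vars, x ∈ V) ∧
        ∀ τ : ℕ → Bool, (∀ C ∈ Lc, (clauseOf C).eval τ = true) →
          ((clauseOf c).subst σ).eval τ = true := by
  classical
  set S : Fin m → Finset ℕ := fun i => (E i).supp.map Fin.valEmbedding with hS
  have hcw := coverDegree_le_two_of_col E hcol
  have memS : ∀ {i : Fin m} {j : Fin n}, j ∈ (E i).supp → (j : ℕ) ∈ S i := fun {i j} hj => by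
    simp only [hS]; exact (Finset.mem_map' Fin.valEmbedding).2 hj
  -- the odd closed components and their routing data
  set OC := (Finset.univ : Finset (Fin m)).powerset.filter fun K =>
    K.Nonempty ∧ IsConn S K ∧ boundary S K = ∅ ∧ ∑ i ∈ K, (E i).2 = 1 with hOC
  have mem_OC : ∀ {K}, K ∈ OC ↔ K.Nonempty ∧ IsConn S K ∧ boundary S K = ∅ ∧ ∑ i ∈ K, (E i).2 = 1 :=
    fun {K} => by simp [hOC]
  have hdat : ∀ K (hK : K ∈ OC), ∃ (T : Fin m' → Finset (Fin m)) (ρ : Fin m' → Fin m)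
      (J : Fin n' → Finset ℕ),
      (∀ a, T a ⊆ K ∧ IsConn S (T a) ∧ (T a).Nonempty) ∧ (∀ a b, a ≠ b → Disjoint (T a) (T b)) ∧
      (∀ a, ρ a ∈ T a) ∧ Function.Injective ρ ∧ (∀ x, J x ⊆ inner S K) ∧
      (∀ x, ∀ v ∈ J x, ∀ i, v ∈ S i → ∃ a, i ∈ T a ∧ x ∈ (E' a).supp) ∧
      (∀ x i, Odd ((S i ∩ J x).card) ↔ ∃ a, ρ a = i ∧ x ∈ (E' a).supp) := by
    intro K hK
    obtain ⟨hne, hc, hb, hs⟩ := mem_OC.1 hK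
    obtain ⟨T, hT1, hT2, hT3⟩ := hemb K hne hc hb hs
    obtain ⟨ρ, J, h1, h2, h3, h4, h5⟩ := exists_routing E E' hcol hcol2 T hT1 hT2 hT3
    exact ⟨T, ρ, J, hT1, hT2, h1, h2, h3, h4, h5⟩
  choose T ρ J hT1 hT2 hρmem hρinj hJin hJrow hJpar using hdat
  -- uniqueness facts
  have huniq : ∀ K (hK : K ∈ OC) K' (hK' : K' ∈ OC) i, i ∈ K → i ∈ K' → K = K' := by
    intro K hK K' hK' i hi hi'
    obtain ⟨-, hc, hb, -⟩ := mem_OC.1 hK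
    obtain ⟨-, hc', hb', -⟩ := mem_OC.1 hK'
    exact closed_eq_of_inter_nonempty hcw hc hb hc' hb' ⟨i, Finset.mem_inter.2 ⟨hi, hi'⟩⟩
  have hρK : ∀ K (hK : K ∈ OC) a, ρ K hK a ∈ K := fun K hK a => (hT1 K hK a).1 (hρmem K hK a)
  have hTuniq : ∀ K (hK : K ∈ OC) K' (hK' : K' ∈ OC) a a' i, i ∈ T K hK a → i ∈ T K' hK' a' →
      K = K' ∧ a = a' := by
    intro K hK K' hK' a a' i hi hi'
    have hKK' := huniq K hK K' hK' i ((hT1 K hK a).1 hi) ((hT1 K' hK' a').1 hi')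
    subst hKK'
    refine ⟨rfl, ?_⟩
    by_contra h
    exact Finset.disjoint_left.1 (hT2 K hK a a' h) hi hi'
  -- roots and the corrected right-hand sides
  have hroot_uniq : ∀ K (hK : K ∈ OC) K' (hK' : K' ∈ OC) a a', ρ K hK a = ρ K' hK' a' →
      K = K' ∧ a = a' := by
    intro K hK K' hK' a a' h
    exact hTuniq K hK K' hK' a a' _ (hρmem K hK a) (h ▸ hρmem K' hK' a')
  -- the corrected right-hand sides and the flips
  set IsRoot : Fin m → Fin m' → Prop := fun i a => ∃ K, ∃ hK : K ∈ OC, ρ K hK a = i with hIsRoot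
  set β : Fin m → ZMod 2 := fun i => (E i).2 + ∑ a, if IsRoot i a then (E' a).2 else 0 with hβ
  set Eβ : Fin m → LinEqMod 2 n := fun i => ((E i).1, β i) with hEβ
  have hEβsupp : ∀ i, (Eβ i).supp = (E i).supp := fun i => rfl
  have heven : ∀ K' : Finset (Fin m), K'.Nonempty → IsConn S K' → boundary S K' = ∅ →
      ∑ i ∈ K', (Eβ i).2 = 0 := by
    intro K' hne hc hb
    change ∑ i ∈ K', ((E i).2 + ∑ a, if IsRoot i a then (E' a).2 else 0) = 0
    rw [Finset.sum_add_distrib, Finset.sum_comm]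
    by_cases hK'OC : K' ∈ OC
    · have h1 : ∑ i ∈ K', (E i).2 = 1 := (mem_OC.1 hK'OC).2.2.2
      have h2 : ∀ a, ∑ i ∈ K', (if IsRoot i a then (E' a).2 else 0) = (E' a).2 := by
        intro a
        rw [Finset.sum_eq_single (ρ K' hK'OC a)]
        · rw [if_pos ⟨K', hK'OC, rfl⟩]
        · intro i hi hne'
          rw [if_neg]
          rintro ⟨K, hK, hKi⟩
          have := huniq K hK K' hK'OC i (hKi ▸ hρK K hK a) hi
          subst this
          exact hne' hKi.symm
        · intro h; exact absurd (hρK K' hK'OC a) h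
      rw [Finset.sum_congr rfl fun a _ => h2 a, hodd', h1]
      decide
    · have h1 : ∑ i ∈ K', (E i).2 = 0 := by
        by_contra h
        exact hK'OC (mem_OC.2 ⟨hne, hc, hb, ((by decide : ∀ a : ZMod 2, a ≠ 0 → a = 1) _ h)⟩)
      have h2 : ∀ a, ∑ i ∈ K', (if IsRoot i a then (E' a).2 else 0) = 0 := by
        intro a
        refine Finset.sum_eq_zero fun i hi => ?_
        rw [if_neg]
        rintro ⟨K, hK, hKi⟩
        have := huniq K hK K' ?_ i (hKi ▸ hρK K hK a) hi
        · subst this; exact hK'OC hK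
        · -- `K'` is a closed component meeting `K ∈ OC`, hence equal to it
          obtain ⟨-, hcK, hbK, -⟩ := mem_OC.1 hK
          have := closed_eq_of_inter_nonempty hcw hcK hbK hc hb ⟨i, Finset.mem_inter.2 ⟨hKi ▸ hρK K hK a, hi⟩⟩
          subst this; exact hK
      rw [Finset.sum_congr rfl fun a _ => h2 a, Finset.sum_const_zero, h1, add_zero]
  obtain ⟨φ, hφ⟩ := exists_assignment_of_even Eβ hcol heven
  have hφ' : ∀ i, ∑ j, (E i).1 j * (if φ j then 1 else 0) = β i := fun i =>
    (holds_blockVals_iff (Eβ i) φ).1 (hφ i)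
  -- where joins live
  have hJrowK : ∀ K (hK : K ∈ OC) x v i, v ∈ J K hK x → v ∈ S i → i ∈ K := by
    intro K hK x v i hv hvi
    have hin := hJin K hK x hv
    rw [mem_inner, coverDegree] at hin
    obtain ⟨i₁, hi₁, i₂, hi₂, hne⟩ := Finset.one_lt_card.1 hin
    obtain ⟨hi₁K, hv₁⟩ := Finset.mem_filter.1 hi₁
    obtain ⟨hi₂K, hv₂⟩ := Finset.mem_filter.1 hi₂
    rcases rows_eq_pair hcw hne hv₁ hv₂ hvi with rfl | rfl
    · exact hi₁K
    · exact hi₂K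
  -- the target variables attached to a source variable
  set O : ℕ → Finset ℕ := fun v => OC.attach.biUnion fun K =>
    (Finset.univ.filter fun x : Fin n' => v ∈ J K.1 K.2 x).map Fin.valEmbedding with hO
  have hO_mem : ∀ v y, y ∈ O v ↔ ∃ K, ∃ hK : K ∈ OC, ∃ x : Fin n', (x : ℕ) = y ∧ v ∈ J K hK x := by
    intro v y
    simp only [hO, Finset.mem_biUnion, Finset.mem_attach, true_and, Finset.mem_map,
      Finset.mem_filter, Finset.mem_univ, Subtype.exists, Fin.valEmbedding_apply]
    constructor
    · rintro ⟨K, hK, x, hx, rfl⟩; exact ⟨K, hK, x, rfl, hx⟩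
    · rintro ⟨K, hK, x, rfl, hx⟩; exact ⟨K, hK, x, hx, rfl⟩
  have hO_supp : ∀ v i, v ∈ S i → ∀ K (hK : K ∈ OC) a, i ∈ T K hK a →
      O v ⊆ (E' a).supp.map Fin.valEmbedding := by
    intro v i hvi K hK a hia y hy
    obtain ⟨K', hK', x, rfl, hvx⟩ := (hO_mem v y).1 hy
    obtain ⟨a', hia', hxa'⟩ := hJrow K' hK' x v hvx i hvi
    obtain ⟨rfl, rfl⟩ := hTuniq K' hK' K hK a' a i hia' hia
    exact Finset.mem_map_of_mem _ hxa'
  have hO_card : ∀ v, (O v).card ≤ k₀ := by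
    intro v
    rcases (O v).eq_empty_or_nonempty with h | ⟨y, hy⟩
    · rw [h]; simp
    · obtain ⟨K, hK, x, rfl, hvx⟩ := (hO_mem v y).1 hy
      have hcov : v ∈ cover S K := Finset.mem_of_mem_filter v (hJin K hK x hvx)
      obtain ⟨i, hiK, hvi⟩ := mem_cover.1 hcov
      obtain ⟨a, hia, -⟩ := hJrow K hK x v hvx i hvi
      calc (O v).card ≤ ((E' a).supp.map Fin.valEmbedding).card :=
            Finset.card_le_card (hO_supp v i hvi K hK a hia)
        _ ≤ k₀ := by rw [Finset.card_map]; exact hsupp' a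
  -- the substitution
  set σ : ℕ → PropForm ℕ := fun v => parityForm (φ v) (O v).toList with hσ
  have hlen : ∀ v, (O v).toList.length ≤ k₀ := fun v => by rw [Finset.length_toList]; exact hO_card v
  refine ⟨σ, fun v => ?_, fun v c => ?_, ?_⟩
  · have h1 := size_parityForm_le (φ v) (O v).toList
    have h2 : 2 ^ (O v).toList.length ≤ 2 ^ k₀ := Nat.pow_le_pow_right (by norm_num) (hlen v)
    change (parityForm (φ v) (O v).toList).size ≤ _
    omega
  · exact (altDepthAux_parityForm_le (φ v) (O v).toList c).trans (Nat.mul_le_mul_left 3 (hlen v))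
  -- semantics of `σ`
  have hval : ∀ (τ : ℕ → Bool) v, (if (σ v).eval τ then (1 : ZMod 2) else 0) =
      (if φ v then 1 else 0) + ∑ y ∈ O v, (if τ y then (1 : ZMod 2) else 0) := by
    intro τ v
    change (if (parityForm (φ v) (O v).toList).eval τ then (1 : ZMod 2) else 0) = _
    rw [ite_eval_parityForm, Finset.sum_map_toList]
  -- row sums under the substituted assignment
  have hrow : ∀ (τ : ℕ → Bool) i, ∑ j, (E i).1 j * (if (σ j).eval τ then (1 : ZMod 2) else 0) =
      β i + ∑ x : Fin n', (if τ x then (1 : ZMod 2) else 0) *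
        (((E i).supp.filter fun j : Fin n => (x : ℕ) ∈ O (j : ℕ)).card : ZMod 2) := by
    intro τ i
    simp_rw [hval τ, mul_add, Finset.sum_add_distrib, hφ' i, add_right_inj]
    rw [sum_coeff_mul]
    -- rewrite the inner sums over target variables
    have hinner : ∀ j : Fin n, ∑ y ∈ O j, (if τ y then (1 : ZMod 2) else 0) =
        ∑ x : Fin n', if (x : ℕ) ∈ O j then (if τ x then (1 : ZMod 2) else 0) else 0 := by
      intro j
      have e : O j = (Finset.univ.filter fun x : Fin n' => (x : ℕ) ∈ O j).map Fin.valEmbedding := by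
        ext y
        simp only [Finset.mem_map, Finset.mem_filter, Finset.mem_univ, true_and,
          Fin.valEmbedding_apply]
        constructor
        · intro hy
          obtain ⟨K, hK, x, rfl, -⟩ := (hO_mem j y).1 hy
          exact ⟨x, hy, rfl⟩
        · rintro ⟨x, hx, rfl⟩; exact hx
      conv_lhs => rw [e]
      rw [Finset.sum_map]
      conv_rhs => rw [← Finset.sum_filter]
      rfl
    simp_rw [hinner]
    rw [Finset.sum_comm]
    refine Finset.sum_congr rfl fun x _ => ?_
    rw [← Finset.sum_filter, Finset.sum_const, nsmul_eq_mul, mul_comm]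
  -- the parity counts
  have hcount : ∀ i (x : Fin n'), (((E i).supp.filter fun j : Fin n => (x : ℕ) ∈ O (j : ℕ)).card : ZMod 2) =
      if (∃ a, IsRoot i a ∧ x ∈ (E' a).supp) then 1 else 0 := by
    intro i x
    by_cases hiK : ∃ K, ∃ hK : K ∈ OC, i ∈ K
    · obtain ⟨K, hK, hi⟩ := hiK
      have hfilt : ((E i).supp.filter fun j : Fin n => (x : ℕ) ∈ O (j : ℕ)) =
          (E i).supp.filter fun j : Fin n => (j : ℕ) ∈ J K hK x := by
        refine Finset.filter_congr fun j hj => ?_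
        have hjS : (j : ℕ) ∈ S i := memS hj
        constructor
        · intro h
          obtain ⟨K', hK', x', hxx', hjx'⟩ := (hO_mem j x).1 h
          have hx' : x' = x := Fin.val_injective hxx'
          subst hx'
          have := huniq K' hK' K hK i (hJrowK K' hK' x' j i hjx' hjS) hi
          subst this
          exact hjx'
        · intro h
          exact (hO_mem j x).2 ⟨K, hK, x, rfl, h⟩
      have hcard : ((E i).supp.filter fun j : Fin n => (j : ℕ) ∈ J K hK x).card = (S i ∩ J K hK x).card := by
        rw [← Finset.filter_mem_eq_inter]
        simp only [hS]
        rw [Finset.filter_map, Finset.card_map]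
        rfl
      rw [hfilt, hcard]
      have hiff : (∃ a, IsRoot i a ∧ x ∈ (E' a).supp) ↔ ∃ a, ρ K hK a = i ∧ x ∈ (E' a).supp := by
        constructor
        · rintro ⟨a, ⟨K', hK', hρ⟩, hxa⟩
          have := huniq K' hK' K hK i (hρ ▸ hρK K' hK' a) hi
          subst this
          exact ⟨a, hρ, hxa⟩
        · rintro ⟨a, hρ, hxa⟩; exact ⟨a, ⟨K, hK, hρ⟩, hxa⟩
      by_cases hodd : Odd ((S i ∩ J K hK x).card)
      · rw [if_pos (hiff.2 ((hJpar K hK x i).1 hodd)), ZMod.natCast_eq_one_iff_odd.2 hodd]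
      · rw [if_neg (fun h => hodd ((hJpar K hK x i).2 (hiff.1 h))),
          ZMod.natCast_eq_zero_iff_even.2 (Nat.not_odd_iff_even.1 hodd)]
    · push Not at hiK
      have hfilt : ((E i).supp.filter fun j : Fin n => (x : ℕ) ∈ O (j : ℕ)) = ∅ := by
        refine Finset.eq_empty_of_forall_notMem fun j hj => ?_
        obtain ⟨hj, h⟩ := Finset.mem_filter.1 hj
        obtain ⟨K', hK', x', -, hjx'⟩ := (hO_mem j x).1 h
        exact hiK K' hK' (hJrowK K' hK' x' j i hjx' (memS hj))
      rw [hfilt, Finset.card_empty, Nat.cast_zero, if_neg]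
      rintro ⟨a, ⟨K, hK, hρ⟩, -⟩
      exact hiK K hK (hρ ▸ hρK K hK a)
  -- consequences: non-root rows always hold, root rows hold when their target row does
  have hnonroot : ∀ (τ : ℕ → Bool) i, (¬ ∃ a, IsRoot i a) →
      (E i).Holds (blockVals 2 1 n fun v => (σ v).eval τ) := by
    intro τ i hno
    rw [holds_blockVals_iff, hrow τ i]
    have h1 : β i = (E i).2 := by
      change (E i).2 + ∑ a, (if IsRoot i a then (E' a).2 else 0) = (E i).2
      rw [Finset.sum_eq_zero fun a _ => if_neg fun h => hno ⟨a, h⟩, add_zero]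
    rw [h1, Finset.sum_eq_zero fun x _ => ?_, add_zero]
    rw [hcount, if_neg (show ¬ ∃ a, IsRoot i a ∧ x ∈ (E' a).supp from fun ⟨a, ha, _⟩ => hno ⟨a, ha⟩),
      mul_zero]
  have hrootrow : ∀ (τ : ℕ → Bool) K (hK : K ∈ OC) a₀,
      (E' a₀).Holds (blockVals 2 1 n' τ) →
      (E (ρ K hK a₀)).Holds (blockVals 2 1 n fun v => (σ v).eval τ) := by
    intro τ K hK a₀ hτ
    have hra : ∀ a, IsRoot (ρ K hK a₀) a ↔ a = a₀ := by
      intro a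
      constructor
      · rintro ⟨K', hK', h⟩; exact (hroot_uniq K' hK' K hK a a₀ h).2
      · rintro rfl; exact ⟨K, hK, rfl⟩
    rw [holds_blockVals_iff, hrow τ]
    have h1 : β (ρ K hK a₀) = (E (ρ K hK a₀)).2 + (E' a₀).2 := by
      change (E (ρ K hK a₀)).2 + ∑ a, (if IsRoot (ρ K hK a₀) a then (E' a).2 else 0) = _
      simp_rw [hra]
      rw [Finset.sum_ite_eq' Finset.univ a₀, if_pos (Finset.mem_univ _)]
    have h2 : ∑ x : Fin n', (if τ x then (1 : ZMod 2) else 0) *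
        (((E (ρ K hK a₀)).supp.filter fun j : Fin n => (x : ℕ) ∈ O (j : ℕ)).card : ZMod 2) = (E' a₀).2 := by
      rw [holds_blockVals_iff, sum_coeff_mul] at hτ
      rw [← hτ]
      rw [← Finset.sum_subset (Finset.subset_univ (E' a₀).supp)]
      · refine Finset.sum_congr rfl fun x hx => ?_
        rw [hcount, if_pos (show ∃ a, IsRoot (ρ K hK a₀) a ∧ x ∈ (E' a).supp from
          ⟨a₀, (hra a₀).2 rfl, hx⟩), mul_one]
      · intro x _ hx
        rw [hcount, if_neg (show ¬ ∃ a, IsRoot (ρ K hK a₀) a ∧ x ∈ (E' a).supp from ?_), mul_zero]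
        rintro ⟨a, ha, hxa⟩
        rw [hra] at ha
        subst ha
        exact hx hxa
    rw [h1, h2]
    generalize (E (ρ K hK a₀)).2 = b
    generalize (E' a₀).2 = c'
    revert b c'; decide
  -- the local implications, clause by clause
  intro c hc
  simp only [sumEncoding, List.mem_flatMap, List.mem_finRange, true_and] at hc
  obtain ⟨i, hi⟩ := hc
  have hclause : ∀ τ : ℕ → Bool, (E i).Holds (blockVals 2 1 n fun v => (σ v).eval τ) →
      ((clauseOf c).subst σ).eval τ = true := by
    intro τ hh
    rw [PropForm.eval_subst, OntoPHPReduction.eval_clauseOf]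
    have hall := eval_equationCNF 1 (E i) (fun v => (σ v).eval τ)
    rw [decide_eq_true hh, CNF.eval_eq_true_iff] at hall
    exact hall c hi
  have hvars : ∀ y ∈ ((clauseOf c).subst σ).vars, ∃ j ∈ (E i).supp, y ∈ O (j : ℕ) := by
    intro y hy
    obtain ⟨v, hv, hyv⟩ := mem_vars_subst hy
    obtain ⟨j, hj, rfl⟩ := exists_mem_supp_of_mem_vars hi hv
    refine ⟨j, hj, Finset.mem_toList.1 ?_⟩
    change y ∈ (parityForm (φ (j : ℕ)) (O (j : ℕ)).toList).vars at hyv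
    exact mem_vars_parityForm hyv
  have hVsub : ∀ a x, x ∈ (E' a).supp → (x : ℕ) ∈ eqVars 1 (E' a) := fun a x hx =>
    mem_eqVars.2 ⟨x, hx, mem_encBlock.2 ⟨0, one_pos, by simp⟩⟩
  have hLcvars : ∀ a, ∀ C ∈ equationCNF 1 (E' a), ∀ x ∈ (clauseOf C).vars, x ∈ eqVars 1 (E' a) := by
    intro a C hC x hx
    obtain ⟨l, hl, rfl⟩ := OntoPHPReduction.exists_of_mem_vars_clauseOf hx
    exact fst_mem_of_mem_canonicalCNF hC hl
  have hLclen : ∀ a, (equationCNF 1 (E' a)).length ≤ 2 ^ k₀ := fun a =>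
    (length_equationCNF_le _).trans (Nat.pow_le_pow_right (by norm_num) (hsupp' a))
  have hVlen : ∀ a, (eqVars 1 (E' a)).length ≤ k₀ := fun a => by
    rw [length_eqVars, mul_one]; exact hsupp' a
  by_cases hTi : ∃ K, ∃ hK : K ∈ OC, ∃ a, i ∈ T K hK a
  · obtain ⟨K, hK, a, hia⟩ := hTi
    have hV : ∀ y ∈ ((clauseOf c).subst σ).vars, y ∈ eqVars 1 (E' a) := by
      intro y hy
      obtain ⟨j, hj, hyO⟩ := hvars y hy
      have hmem := hO_supp (j : ℕ) i (memS hj) K hK a hia hyO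
      obtain ⟨x, hx, rfl⟩ := Finset.mem_map.1 hmem
      exact hVsub a x hx
    by_cases hroot : ∃ a₀, IsRoot i a₀
    · obtain ⟨a₀, K', hK', hρ⟩ := hroot
      obtain ⟨rfl, rfl⟩ := hTuniq K' hK' K hK a₀ a i (hρ ▸ hρmem K' hK' a₀) hia
      refine ⟨equationCNF 1 (E' a₀), eqVars 1 (E' a₀), ?_, hLclen a₀, nodup_eqVars 1 _, hVlen a₀, hV,
        hLcvars a₀, ?_⟩
      · intro C hC
        simp only [sumEncoding, List.mem_flatMap, List.mem_finRange, true_and]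
        exact ⟨a₀, hC⟩
      · intro τ hτ
        refine hclause τ ?_
        rw [← hρ]
        refine hrootrow τ K' hK' a₀ ?_
        have hall := eval_equationCNF 1 (E' a₀) τ
        have hev : (equationCNF 1 (E' a₀)).eval τ = true := by
          rw [CNF.eval_eq_true_iff]
          intro C hC
          have := hτ C hC
          rwa [OntoPHPReduction.eval_clauseOf] at this
        rw [hev] at hall
        exact of_decide_eq_true hall.symm
    · refine ⟨[], eqVars 1 (E' a), by simp, by simp, nodup_eqVars 1 _, hVlen a, hV, by simp, ?_⟩
      intro τ _
      exact hclause τ (hnonroot τ i hroot)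
  · push Not at hTi
    have hV : ∀ y ∈ ((clauseOf c).subst σ).vars, y ∈ ([] : List ℕ) := by
      intro y hy
      obtain ⟨j, hj, hyO⟩ := hvars y hy
      obtain ⟨K', hK', x, -, hjx⟩ := (hO_mem _ _).1 hyO
      obtain ⟨a', hia', -⟩ := hJrow K' hK' x (j : ℕ) hjx i (memS hj)
      exact absurd hia' (hTi K' hK' a')
    have hroot : ¬ ∃ a₀, IsRoot i a₀ := by
      rintro ⟨a₀, K', hK', hρ⟩
      exact hTi K' hK' a₀ (hρ ▸ hρmem K' hK' a₀)
    refine ⟨[], [], by simp, by simp, List.nodup_nil, by simp, hV, by simp, ?_⟩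
    intro τ _
    exact hclause τ (hnonroot τ i hroot)

end Summit.PneNP.PneNP.Theorems.ColumnTwo
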